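import Summits.RiemannHypothesis.RiemannHypothesis.Theorems.PfPersistenceF1TemplateLandauPrep

/-!
# PF persistence, fake seat 1 — THEOREM F1-T₁: the template line density changes sign (Landau)

Unit `pub-rhpf-fake-1` of the `pub-rhpf` cell (mechanism / rigidity campaign; **no RH claims**);
FAKES §1.8.3′.  With `H_t = templateLD t` (archimedean weight minus twice the prime sum plus the
planted pole term) and `N_t = tmplN t` its continued Mellin numerator
(`mellinIoi_templateLD : M[H_t](s) = N_t(s)/s`, `tmplN_zero : N_t(0) = 0`), we run MV's proof of
Theorem 15.3 (the tree's `PsiOscillation.false_of_eventually_le`, [MontgomeryVaughan2007]) for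
`H_t` at a zero `ρ₀` of `ζ` with `Re ρ₀ ≥ 1/2`, granting that NO zero of `ζ` with real part `≥ 1/2`
has ordinate `±t` (at such a zero the pole of `N_t(s)/s` would be real and Landau's lemma is
silent): for `η = ±1` and `0 < c < 1/|ρ₀ − 1/2 − it|` the one-sided bound
`η H_t(x) ≤ c x^{Re ρ₀ − 1/2}` cannot hold for all large `x` (`false_of_eventually_le`); hence
`H_t` exceeds `c x^{Re ρ₀ − 1/2}` and drops below `−c x^{Re ρ₀ − 1/2}` for arbitrarily large `x`
(`frequently_lt_and_lt`) and in particular changes sign infinitely often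
(`frequently_pos_and_neg`).  The abscissa is `a = Re ρ₀ − 1/2 ≥ 0`, possibly `0`, where
`N_t(0) = 0` (F1-S (a)) keeps `N_t(s)/s` regular; no zero-free corridor at the height of the pole is
needed (the polynomial identity `Ψ ≡ 0` transports `F = Φ` across the half-plane).  Unconditional;
nothing about RH.
-/

set_option linter.dupNamespace false

noncomputable section

open Complex Filter Topology Set MeasureTheory Metric

namespace Summit.RiemannHypothesis.RiemannHypothesis.Theorems.PfPersistence.Fake1.TemplateLandau

open Literature.NumberTheory.LFunctions Literature.NumberTheory.LFunctions.Landau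
open Summit.RiemannHypothesis.RiemannHypothesis.Theorems.PfPersistence.Fake1.TemplateMellin
open Summit.RiemannHypothesis.RiemannHypothesis.Theorems.PfPersistence.Fake1.TemplateAbscissa

/-! ## THEOREM F1-T₁: the contradiction from a one-sided bound -/

/-- **THEOREM F1-T₁ (core).**  Let `ρ₀` be a zero of `ζ` with `Re ρ₀ ≥ 1/2`, and suppose no zero of
`ζ` with real part `≥ 1/2` has ordinate `t` or `−t`.  Then for `η = ±1` and `0 < c < 1/|ρ₀ − 1/2 − it|`
the bound `η H_t(x) ≤ c x^{Re ρ₀ − 1/2}` fails for arbitrarily large `x`.  MV's proof of Thm. 15.3 run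
for `H_t`: `g = c x^{a} − η H_t ≥ 0` beyond `X₀` (`a = Re ρ₀ − 1/2`); Landau's lemma continues
`F = M[g]` to `Re s > a` because `Φ = c/(s − a) − η N_t(s)/s` is holomorphic on a strip about
`(a, ∞)` (the gap `δ` of `exists_gap`); the polynomial identity `Ψ ≡ 0` transports `F = Φ` to the
whole half-plane off the zeros; at `s = ρ₀ − w₁ + u` the log-derivatives contribute `(m + m')/u`
(`m ≥ 1`), at `σ = a + u` only `c/u + O(1)` (`N_t(0) = 0` when `a = 0`), and positivity
`Re (F(σ) + w F(s)) ≥ −C₀` contradicts `(c − 1/|s₀|)/u + O(1) → −∞`.  [folklore; mechanism of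
MontgomeryVaughan2007 Thm. 15.3] -/
theorem false_of_eventually_le {t : ℝ} {ρ₀ : ℂ} (h0 : riemannZeta ρ₀ = 0) (hb : 1 / 2 ≤ ρ₀.re)
    (ht : ∀ ρ : ℂ, riemannZeta ρ = 0 → 1 / 2 ≤ ρ.re → ρ.im ≠ t ∧ ρ.im ≠ -t) {c η : ℝ}
    (hη : η = 1 ∨ η = -1) (hc0 : 0 < c) (hc : c < 1 / ‖ρ₀ - (1 / 2 + t * I)‖)
    (hev : ∀ᶠ x in atTop, η * templateLD t x ≤ c * x ^ (ρ₀.re - 1 / 2)) : False := by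
  -- the zero `ρ₀`, the abscissa `a`, the pole `s₀ = ρ₀ − w₁`
  have hb1 : ρ₀.re < 1 := by
    by_contra h
    exact riemannZeta_ne_zero_of_one_le_re (not_lt.1 h) h0
  have hρ1 : ρ₀ ≠ 1 := by intro h; rw [h] at hb1; simp at hb1
  have hζ₁0 : riemannZeta₁ ρ₀ = 0 := (riemannZeta₁_eq_zero_iff hρ1).2 h0
  obtain ⟨hγt, -⟩ := ht ρ₀ h0 hb
  set a : ℝ := ρ₀.re - 1 / 2 with hadef
  have ha0 : 0 ≤ a := by linarith
  have ha1 : a ≤ 1 := by linarith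
  set s₀ : ℂ := ρ₀ - wone t with hs₀def
  have hs₀re : s₀.re = a := by simp [hs₀def, wone, hadef]
  have hs₀im : s₀.im = ρ₀.im - t := by simp [hs₀def, wone]
  have hγ : s₀.im ≠ 0 := by rw [hs₀im]; exact sub_ne_zero.2 hγt
  have hs₀0 : s₀ ≠ 0 := by intro h; apply hγ; rw [h]; simp
  have hs₀n : 0 < ‖s₀‖ := norm_pos_iff.2 hs₀0
  have hcn : c < 1 / ‖s₀‖ := hc
  set η' : ℝ := -η with hη'def
  have hη' : η' = 1 ∨ η' = -1 := by rcases hη with h | h <;> simp [hη'def, h]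
  have hηC : -(η : ℂ) = (η' : ℂ) := by simp [hη'def]
  -- the non-negative function `A`
  obtain ⟨X₁, hX₁⟩ := eventually_atTop.1 hev
  set X₀ : ℝ := max X₁ 1 with hX₀def
  have hX₀ : 1 ≤ X₀ := le_max_right _ _
  set A : ℝ → ℝ := cmpFn t c a η with hAdef
  have hAm : Measurable A := measurable_cmpFn t c a η
  have hpos : ∀ x, X₀ < x → 0 ≤ A x := fun x hx ↦ by
    have := hX₁ x ((le_max_left _ _).trans hx.le)
    simp only [hAdef, cmpFn]
    linarith
  set KH : ℝ := |tmplA t| + 2 * (Real.log 4 + 4) + 4 with hKH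
  have hAbs : ∀ x, 1 < x → |A x| ≤ (c + KH) * x := fun x hx ↦ abs_cmpFn_le hc0.le ha1 hη hx
  have hint : IntegrableOn (fun x ↦ A x * x ^ (-((2 : ℝ) + 1))) (Ioi 1) :=
    integrableOn_rpow_of_abs_le_mul_self hAm hAbs (by norm_num)
  -- the gap `δ` and the strip `W₀ = {Re s > a, |Im s| < 2δ}`
  obtain ⟨δ, hδ, hδ1, hgap⟩ := exists_gap ht
  set W₀ : Set ℂ := {s : ℂ | a < s.re ∧ -(2 * δ) < s.im ∧ s.im < 2 * δ} with hW₀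
  have hW₀o : IsOpen W₀ :=
    (isOpen_lt continuous_const Complex.continuous_re).inter
      ((isOpen_lt continuous_const Complex.continuous_im).inter
        (isOpen_lt Complex.continuous_im continuous_const))
  have hW₀c : Convex ℝ W₀ := by
    have : W₀ = {s : ℂ | a < s.re} ∩ ({s : ℂ | -(2 * δ) < s.im} ∩ {s : ℂ | s.im < 2 * δ}) := by
      ext s; simp [hW₀]
    rw [this]
    exact (convex_halfSpace_re_gt _).inter ((convex_halfSpace_im_gt _).inter (convex_halfSpace_im_lt _))
  have hW₀r : ∀ σ' : ℝ, a < σ' → σ' ≤ 2 + 1 → (σ' : ℂ) ∈ W₀ := by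
    intro σ' h1 _
    simp only [hW₀, Set.mem_setOf_eq, Complex.ofReal_re, Complex.ofReal_im]
    exact ⟨h1, by linarith, by linarith⟩
  -- the shifted `ζ₁` do not vanish on `{Re s > 2} ∪ W₀`
  have hZ : ∀ s ∈ ({s : ℂ | (2 : ℝ) < s.re} ∪ W₀),
      riemannZeta₁ (s + wone t) ≠ 0 ∧ riemannZeta₁ (s + wzero t) ≠ 0 := by
    rintro s (hs | hs)
    · have hs' : (2 : ℝ) < s.re := hs
      have key : ∀ w : ℂ, w.re = 1 / 2 → riemannZeta₁ (s + w) ≠ 0 := by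
        intro w hw
        have hre : 1 ≤ (s + w).re := by simp [hw]; linarith
        have hne : s + w ≠ 1 := by
          intro h; have := congrArg Complex.re h; simp [hw] at this; linarith
        rw [Ne, riemannZeta₁_eq_zero_iff hne]
        exact riemannZeta_ne_zero_of_one_le_re hre
      exact ⟨key _ (by simp [wone]), key _ (by simp [wzero])⟩
    · have ha' : ρ₀.re - 1 / 2 < s.re := hs.1
      exact ⟨zeta₁_shift_ne_zero (Or.inl rfl) hδ1 hb hgap ha' hs.2.1 hs.2.2,
        zeta₁_shift_ne_zero (Or.inr rfl) hδ1 hb hgap ha' hs.2.1 hs.2.2⟩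
  have haW : ∀ s ∈ ({s : ℂ | (2 : ℝ) < s.re} ∪ W₀), a < s.re := by
    rintro s (hs | hs)
    · have hs' : (2 : ℝ) < s.re := hs
      linarith
    · exact hs.1
  -- `Φ` is holomorphic there and agrees with `M[A]` on `Re s > 2`
  have hΦd : DifferentiableOn ℂ (cont t c a η) ({s : ℂ | (2 : ℝ) < s.re} ∪ W₀) := by
    intro s hs
    have has := haW s hs
    have hs0 : s ≠ 0 := by intro h; rw [h] at has; simp at has; linarith
    have hsa : s - (a : ℂ) ≠ 0 := by
      intro h; have := congrArg Complex.re h; simp at this; linarith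
    obtain ⟨h1, h0'⟩ := hZ s hs
    have hN : DifferentiableAt ℂ (tmplN t) s := (analyticAt_tmplN h1 h0').differentiableAt
    apply DifferentiableAt.differentiableWithinAt
    unfold cont
    fun_prop (disch := assumption)
  have hagree : EqOn (cont t c a η) (mellinIoi A) {s : ℂ | (2 : ℝ) < s.re} := by
    intro s hs
    have hs' : (2 : ℝ) < s.re := hs
    exact (mellinIoi_cmpFn ha1 (by linarith)).symm
  -- Landau's lemma: absolute convergence for every `σ > a`
  have hI : ∀ σ : ℝ, a < σ → IntegrableOn (fun x ↦ A x * x ^ (-(σ + 1))) (Ioi 1) := fun σ hσ ↦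
    Landau.integrableOn_of_differentiableOn_union_convex hAm hint hX₀ hpos (by linarith : a < 2)
      hW₀o hW₀c hW₀r hΦd hagree hσ
  set F : ℂ → ℂ := mellinIoi A with hFdef
  have hFd : DifferentiableOn ℂ F {s : ℂ | a < s.re} := differentiableOn_mellinIoi_of_forall hAm hI
  -- the polynomial identity `Ψ ≡ 0` on `Re s > a`
  have hZd : ∀ w : ℂ, Differentiable ℂ (fun z : ℂ ↦ riemannZeta₁ (z + w)) := fun w ↦
    differentiable_riemannZeta₁.comp (differentiable_id.add_const w)
  have hdZ : Differentiable ℂ (deriv riemannZeta₁) := fun z ↦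
    (differentiable_riemannZeta₁.analyticAt z).deriv.differentiableAt
  have hdZd : ∀ w : ℂ, Differentiable ℂ (fun z : ℂ ↦ deriv riemannZeta₁ (z + w)) := fun w ↦
    hdZ.comp (differentiable_id.add_const w)
  set Ψ : ℂ → ℂ := fun s ↦ s * (s - a) * riemannZeta₁ (s + wone t) * riemannZeta₁ (s + wzero t) * F s -
      (c * s * riemannZeta₁ (s + wone t) * riemannZeta₁ (s + wzero t) -
        η * (s - a) * (((tmplA t : ℂ) + 4 / (1 + 4 * (t : ℂ) ^ 2)) * riemannZeta₁ (s + wone t) *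
          riemannZeta₁ (s + wzero t) + deriv riemannZeta₁ (s + wone t) * riemannZeta₁ (s + wzero t) +
          riemannZeta₁ (s + wone t) * deriv riemannZeta₁ (s + wzero t))) with hΨ
  have hΨd : DifferentiableOn ℂ Ψ {s : ℂ | a < s.re} := by
    intro s hs
    have hF : DifferentiableAt ℂ F s := (hFd s hs).differentiableAt ((isOpen_re_gt a).mem_nhds hs)
    have h1 := hZd (wone t) s
    have h0' := hZd (wzero t) s
    have hd1 := hdZd (wone t) s
    have hd0 := hdZd (wzero t) s
    apply DifferentiableAt.differentiableWithinAt
    have hid : DifferentiableAt ℂ (fun z : ℂ ↦ z) s := differentiableAt_id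
    simp only [hΨ]
    fun_prop
  have hΨ0 : EqOn Ψ 0 {s : ℂ | a < s.re} := by
    have hΨa : AnalyticOnNhd ℂ Ψ {s : ℂ | a < s.re} := hΨd.analyticOnNhd (isOpen_re_gt a)
    have h3 : (3 : ℂ) ∈ {s : ℂ | (2 : ℝ) < s.re} := by simp; norm_num
    have hev3 : Ψ =ᶠ[𝓝 (3 : ℂ)] 0 := by
      filter_upwards [(isOpen_re_gt 2).mem_nhds h3] with s hs
      have hs2 : (2 : ℝ) < s.re := hs
      have hFs : F s = cont t c a η s := (hagree hs).symm
      obtain ⟨hζ1, hζ0⟩ := hZ s (Or.inl hs)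
      have hs0 : s ≠ 0 := by intro h; rw [h] at hs2; simp at hs2; linarith
      have hsa : s - (a : ℂ) ≠ 0 := by
        intro h; have := congrArg Complex.re h; simp at this; linarith
      simp only [hΨ, hFs, cont, tmplN, logDeriv_apply, Pi.zero_apply]
      field_simp
      ring
    have h3' : (3 : ℂ) ∈ {s : ℂ | a < s.re} := by simp; linarith
    exact hΨa.eqOn_zero_of_preconnected_of_eventuallyEq_zero
      (convex_halfSpace_re_gt a).isPreconnected h3' hev3
  -- hence `F = Φ` off the zeros, on the whole half-plane
  have hFcont : ∀ z : ℂ, a < z.re → z ≠ 0 → riemannZeta₁ (z + wone t) ≠ 0 →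
      riemannZeta₁ (z + wzero t) ≠ 0 → F z = cont t c a η z := by
    intro z hz hz0 h1 h0'
    have hza : z - (a : ℂ) ≠ 0 := by
      intro h; have := congrArg Complex.re h; simp at this; linarith
    have h := hΨ0 hz
    simp only [hΨ, Pi.zero_apply, sub_eq_zero] at h
    have h3 : F z = (c * z * riemannZeta₁ (z + wone t) * riemannZeta₁ (z + wzero t) -
        η * (z - a) * (((tmplA t : ℂ) + 4 / (1 + 4 * (t : ℂ) ^ 2)) * riemannZeta₁ (z + wone t) *
          riemannZeta₁ (z + wzero t) + deriv riemannZeta₁ (z + wone t) * riemannZeta₁ (z + wzero t) +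
          riemannZeta₁ (z + wone t) * deriv riemannZeta₁ (z + wzero t))) /
        (z * (z - a) * riemannZeta₁ (z + wone t) * riemannZeta₁ (z + wzero t)) := by
      rw [← h]; field_simp
    rw [h3]
    simp only [cont, tmplN, logDeriv_apply]
    field_simp
  -- `ζ₁(a + w₁) ζ₁(a + w₀) ≠ 0` (the points `Re ρ₀ ± it` are not zeros, by `ht`)
  have hZa : ∀ w : ℂ, (w = wone t ∨ w = wzero t) → riemannZeta₁ ((a : ℂ) + w) ≠ 0 := by
    intro w hw
    have hre : ((a : ℂ) + w).re = ρ₀.re := by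
      rcases hw with rfl | rfl <;> simp [wone, wzero, hadef]
    have him : ((a : ℂ) + w).im = t ∨ ((a : ℂ) + w).im = -t := by
      rcases hw with rfl | rfl <;> simp [wone, wzero]
    have hne1 : (a : ℂ) + w ≠ 1 := by
      intro h; have := congrArg Complex.re h; rw [hre] at this; simp at this; linarith
    rw [Ne, riemannZeta₁_eq_zero_iff hne1]
    intro hz
    obtain ⟨h1, h2⟩ := ht _ hz (by rw [hre]; exact hb)
    rcases him with h | h
    · exact h1 h
    · exact h2 h
  -- the `O(1)` inputs: `N_t(σ)/σ`, the log-derivatives at `ρ₀` and at `ρ₁ = s₀ + w₀`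
  obtain ⟨C₁, e5⟩ := exists_bound_tmplN_div (t := t) ha0 (hZa _ (Or.inl rfl)) (hZa _ (Or.inr rfl))
    (fun ha ↦ by
      apply tmplN_zero
      have h := hZa _ (Or.inl rfl)
      rw [ha] at h
      have hne : wone t ≠ 1 := by
        intro h'; have := congrArg Complex.re h'; norm_num [wone] at this
      have h' : riemannZeta₁ (wone t) ≠ 0 := by simpa using h
      exact fun hz ↦ h' ((riemannZeta₁_eq_zero_iff hne).2 hz))
  obtain ⟨m, B₁, hm, e1⟩ := exists_logDeriv_sub_div_bound ρ₀
  have hm1 : 1 ≤ m := hm hζ₁0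
  obtain ⟨m', B₂, -, e2⟩ := exists_logDeriv_sub_div_bound (s₀ + wzero t)
  set M : ℕ := m + m' with hMdef
  have hM : 1 ≤ M := le_add_right hm1
  set K : ℂ := (tmplA t : ℂ) + 4 / (1 + 4 * (t : ℂ) ^ 2) with hK
  set B₀ : ℝ := ‖K‖ + B₁ + B₂ + 1 with hB₀
  -- the head constant `C₀`
  have hloc : IntegrableOn (fun x ↦ |A x| * x ^ (-(a + 1))) (Ioc 1 X₀) := by
    refine Measure.integrableOn_of_bounded measure_Ioc_lt_top.ne
      (((continuous_abs.measurable.comp hAm).mul (measurable_id.pow_const _))).aestronglyMeasurable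
      (M := (c + KH) * X₀) ?_
    rw [ae_restrict_iff' measurableSet_Ioc]
    refine Eventually.of_forall fun x hx ↦ ?_
    have hx0 : 0 < x := zero_lt_one.trans hx.1
    have hpow : x ^ (-(a + 1)) ≤ 1 := Real.rpow_le_one_of_one_le_of_nonpos hx.1.le (by linarith)
    have hKH0 : 0 ≤ c + KH := by positivity
    rw [Real.norm_eq_abs, abs_mul, abs_abs, abs_of_pos (Real.rpow_pos_of_pos hx0 _)]
    calc |A x| * x ^ (-(a + 1)) ≤ (c + KH) * x * 1 :=
          mul_le_mul (hAbs x hx.1) hpow (Real.rpow_nonneg hx0.le _) (by positivity)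
      _ ≤ (c + KH) * X₀ := by rw [mul_one]; gcongr; exact hx.2
  set C₀ : ℝ := 2 * ∫ x in Ioc 1 X₀, |A x| * x ^ (-(a + 1)) with hC₀
  -- the total `O(1)` constant and the choice of `u`
  set T : ℝ := C₁ + c / |s₀.im| + M / s₀.im ^ 2 + (B₀ + 1) / |s₀.im| with hT
  have hgap' : 0 < 1 / ‖s₀‖ - c := by linarith
  have e3 : ∀ᶠ u : ℝ in 𝓝[>] 0, u < 1 := nhdsWithin_le_nhds (Iio_mem_nhds one_pos)
  have e4 : ∀ᶠ u : ℝ in 𝓝[>] 0, u * (|T| + |C₀| + 1) < 1 / ‖s₀‖ - c := by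
    have htt : Tendsto (fun u : ℝ ↦ u * (|T| + |C₀| + 1)) (𝓝 0) (𝓝 0) := by
      have := (tendsto_id (x := 𝓝 (0 : ℝ))).mul_const (|T| + |C₀| + 1)
      simpa using this
    exact nhdsWithin_le_nhds (htt (Iio_mem_nhds hgap'))
  have e0 : ∀ᶠ u : ℝ in 𝓝[>] 0, 0 < u := self_mem_nhdsWithin
  obtain ⟨u, hu0, ⟨hZ1u, hE1⟩, ⟨hZ0u, hE0⟩, hq, hu1, huT⟩ :=
    (e0.and (e1.and (e2.and (e5.and (e3.and e4))))).exists
  -- the two points `s = s₀ + u` and `σ = a + u`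
  set s : ℂ := s₀ + u with hsdef
  set σ : ℝ := a + u with hσdef
  have hsre : s.re = σ := by simp [hsdef, hσdef, hs₀re]
  have hσa : a < σ := by rw [hσdef]; linarith
  have hsH : s ∈ {z : ℂ | a < z.re} := by
    show a < s.re
    rw [hsre]; exact hσa
  have hsim : s.im = s₀.im := by simp [hsdef]
  have hs0 : s ≠ 0 := by intro h; apply hγ; rw [← hsim, h]; simp
  have hsw1 : s + wone t = ρ₀ + u := by simp only [hsdef, hs₀def]; ring
  have hsw0 : s + wzero t = s₀ + wzero t + u := by simp only [hsdef]; ring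
  have huC : (u : ℂ) ≠ 0 := ofReal_ne_zero.2 hu0.ne'
  -- `F(s) = c/(s−a) + η' ((M/u + D + 1)/s)`
  set E₁ : ℂ := deriv riemannZeta₁ (ρ₀ + u) / riemannZeta₁ (ρ₀ + u) - m / u with hE₁def
  set E₀ : ℂ := deriv riemannZeta₁ (s₀ + wzero t + u) / riemannZeta₁ (s₀ + wzero t + u) - m' / u
    with hE₀def
  set D : ℂ := K + E₁ + E₀ - 1 with hDdef
  have hDb : ‖D‖ ≤ B₀ := by
    rw [hDdef, hB₀]
    calc ‖K + E₁ + E₀ - 1‖ ≤ ‖K + E₁ + E₀‖ + ‖(1 : ℂ)‖ := norm_sub_le _ _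
      _ ≤ ‖K‖ + ‖E₁‖ + ‖E₀‖ + 1 := by
          rw [norm_one]
          have := norm_add₃_le (a := K) (b := E₁) (c := E₀)
          linarith
      _ ≤ ‖K‖ + B₁ + B₂ + 1 := by gcongr
  have hFs : F s = c / (s - a) + η' * ((((M : ℂ)) / u + D + 1) / s) := by
    rw [hFcont s hsH hs0 (by rw [hsw1]; exact hZ1u) (by rw [hsw0]; exact hZ0u)]
    simp only [cont, tmplN, logDeriv_apply, hsw1, hsw0, ← hηC, hDdef, hE₁def, hE₀def, hMdef, hK]
    push_cast
    ring
  -- `F(σ) = c/u + η' q`, `q = N_t(σ)/σ`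
  have hσ0' : 0 < σ := by linarith
  have hσW : ((σ : ℝ) : ℂ) ∈ ({s : ℂ | (2 : ℝ) < s.re} ∪ W₀) := Or.inr (hW₀r σ hσa (by linarith))
  obtain ⟨hζσ1, hζσ0⟩ := hZ _ hσW
  have hσ0 : ((σ : ℝ) : ℂ) ≠ 0 := ofReal_ne_zero.2 hσ0'.ne'
  have hσau : ((σ : ℝ) : ℂ) - a = u := by rw [hσdef]; push_cast; ring
  have hFσ : F σ = c / u + η' * (tmplN t σ / σ) := by
    rw [hFcont σ (by simpa using hσa) hσ0 hζσ1 hζσ0]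
    simp only [cont, hσau, ← hηC]
    ring
  -- the bounds
  set w : ℂ := -η' * s₀ / (‖s₀‖ : ℂ) with hwdef
  have hηabs : |η'| = 1 := by rcases hη' with h | h <;> simp [h]
  have hw1 : ‖w‖ ≤ 1 := by
    rw [hwdef, norm_div, norm_mul, norm_neg, Complex.norm_real, Real.norm_eq_abs, hηabs, one_mul,
      Complex.norm_real, Real.norm_eq_abs, abs_of_pos hs₀n, div_self hs₀n.ne']
  have hlow := re_mellinIoi_add_mul_ge hAm hX₀ hpos hσa.le (hI σ hσa) hloc hsre hw1
  have hup := re_endgame_le (C₁ := C₁) (q := tmplN t σ / σ) (D := D) hη' hu0 hM hc0.le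
    hγ hsdef hwdef hq hDb
  have heq : mellinIoi A σ + w * mellinIoi A s = (c / u : ℂ) + η' * (tmplN t σ / σ) +
      w * (c / (s - (s₀.re : ℂ)) + η' * (((M : ℂ) / u + D + 1) / s)) := by
    change F σ + w * F s = _
    rw [hFσ, hFs, hs₀re]
  rw [heq] at hlow
  have h1 : -C₀ ≤ (c - 1 / ‖s₀‖) / u + T := hlow.trans hup
  -- contradiction
  have h2 : |T| + |C₀| + 1 < (1 / ‖s₀‖ - c) / u := by
    rw [lt_div_iff₀ hu0]; linarith
  have h3 : (c - 1 / ‖s₀‖) / u = -((1 / ‖s₀‖ - c) / u) := by ring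
  rw [h3] at h1
  linarith [le_abs_self T, le_abs_self C₀]

/-- **THEOREM F1-T₁ (both signs).**  Under the hypotheses of `false_of_eventually_le`, for every
`0 < c < 1/|ρ₀ − 1/2 − it|`: `H_t(x) > c x^{Re ρ₀ − 1/2}` for arbitrarily large `x` AND
`H_t(x) < −c x^{Re ρ₀ − 1/2}` for arbitrarily large `x`; in particular the template line density
changes sign infinitely often. [folklore] -/
theorem frequently_lt_and_lt {t : ℝ} {ρ₀ : ℂ} (h0 : riemannZeta ρ₀ = 0) (hb : 1 / 2 ≤ ρ₀.re)
    (ht : ∀ ρ : ℂ, riemannZeta ρ = 0 → 1 / 2 ≤ ρ.re → ρ.im ≠ t ∧ ρ.im ≠ -t) {c : ℝ}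
    (hc0 : 0 < c) (hc : c < 1 / ‖ρ₀ - (1 / 2 + t * I)‖) :
    (∃ᶠ x in atTop, c * x ^ (ρ₀.re - 1 / 2) < templateLD t x) ∧
      (∃ᶠ x in atTop, templateLD t x < -(c * x ^ (ρ₀.re - 1 / 2))) := by
  constructor
  · by_contra h
    refine false_of_eventually_le h0 hb ht (Or.inl rfl) hc0 hc ?_
    filter_upwards [not_frequently.1 h] with x hx
    rw [one_mul]
    exact not_lt.1 hx
  · by_contra h
    refine false_of_eventually_le h0 hb ht (Or.inr rfl) hc0 hc ?_
    filter_upwards [not_frequently.1 h] with x hx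
    have := not_lt.1 hx
    linarith

/-- **Sign change of the template line density** (FAKES §1.8.3′, THEOREM F1-T₁ as recorded): if `ζ`
has a zero `ρ₀` with `Re ρ₀ ≥ 1/2` (it does: `ρ` or `1 − conj ρ`) and no zero with real part `≥ 1/2`
has ordinate `±t`, then `H_t` is positive for arbitrarily large `x` and negative for arbitrarily
large `x`. [folklore] -/
theorem frequently_pos_and_neg {t : ℝ} {ρ₀ : ℂ} (h0 : riemannZeta ρ₀ = 0) (hb : 1 / 2 ≤ ρ₀.re)
    (ht : ∀ ρ : ℂ, riemannZeta ρ = 0 → 1 / 2 ≤ ρ.re → ρ.im ≠ t ∧ ρ.im ≠ -t) :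
    (∃ᶠ x in atTop, 0 < templateLD t x) ∧ (∃ᶠ x in atTop, templateLD t x < 0) := by
  have hγt := (ht ρ₀ h0 hb).1
  have hne : ρ₀ - (1 / 2 + t * I) ≠ 0 := by
    intro h
    have := congrArg Complex.im h
    simp at this
    exact hγt (by linarith)
  have hn : 0 < 1 / ‖ρ₀ - (1 / 2 + t * I)‖ := by positivity
  obtain ⟨h1, h2⟩ := frequently_lt_and_lt h0 hb ht (c := 1 / ‖ρ₀ - (1 / 2 + t * I)‖ / 2)
    (by positivity) (by linarith)
  refine ⟨(h1.and_eventually (eventually_ge_atTop 0)).mono fun x hx ↦ ?_,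
    (h2.and_eventually (eventually_ge_atTop 0)).mono fun x hx ↦ ?_⟩
  · obtain ⟨hx, hx0⟩ := hx
    have : 0 ≤ 1 / ‖ρ₀ - (1 / 2 + t * I)‖ / 2 * x ^ (ρ₀.re - 1 / 2) :=
      mul_nonneg (by positivity) (Real.rpow_nonneg hx0 _)
    linarith
  · obtain ⟨hx, hx0⟩ := hx
    have : 0 ≤ 1 / ‖ρ₀ - (1 / 2 + t * I)‖ / 2 * x ^ (ρ₀.re - 1 / 2) :=
      mul_nonneg (by positivity) (Real.rpow_nonneg hx0 _)
    linarith

end Summit.RiemannHypothesis.RiemannHypothesis.Theorems.PfPersistence.Fake1.TemplateLandau
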